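import Summits.AtomisticToContinuum.Crystallization.Theses.ExcessDecayLiouville
import Summits.AtomisticToContinuum.Crystallization.Theorems.ChargedEnergyGap.Negative.Unconditional

/-!
# Route `ExcessDecayLiouville`, item stmt-AtomisticToContinuum-0626 `CrysEnergyLimit`

The energetic half of crystallization in the form shared by the board:
`E(N)/N → ⨅_Q e_LJ(Q)` for the Lennard-Jones potential in `ℝ³`, where the infimum runs over all
periodic (multi-lattice) configurations `Q : PeriodicConfiguration 3`.

The statement is closed by the in-tree theorem
`Summit.AtomisticToContinuum.Crystallization.Theorems.ChargedEnergyGapNegative.crysEnergyLimit`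
(module `…Theorems.ChargedEnergyGap.Negative.Unconditional`), whose proof is:
the thermodynamic limit `e_∞ = lim E(N)/N` exists (`BlancLewin2015_8_holds`);
`e_∞ ≤ e(Q)` for every periodic `Q` (blocks of `Q` are trial states); and
`⨅_Q e(Q) ≤ E(N)/N` for every `N ≥ 1` (periodise any finite injective configuration with a large
cubic period: cross-cell pairs sit at distance `> 1`, where `V_LJ < 0`).
Hence `e_∞ = ⨅_Q e(Q)`.  Note this identifies the limit with the periodic INFIMUM; attainment of the
infimum (a periodic minimiser) is item 0627 and is not used here.
-/

namespace Summit.AtomisticToContinuum.Crystallization.Theorems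

open Literature.MathematicalPhysics.StatisticalMechanics

/-- **Item stmt-AtomisticToContinuum-0626** (`CrysEnergyLimit`, route `ExcessDecayLiouville`):
`E(N)/N → ⨅_{Q periodic} e_LJ(Q)` for Lennard-Jones in `ℝ³`.  Closed by
`ChargedEnergyGapNegative.crysEnergyLimit`. -/
theorem crysEnergyLimit_proof :
    Summit.AtomisticToContinuum.Crystallization.Theses.ExcessDecayLiouville.CrysEnergyLimit := by
  unfold Summit.AtomisticToContinuum.Crystallization.Theses.ExcessDecayLiouville.CrysEnergyLimit
  exact ChargedEnergyGapNegative.crysEnergyLimit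

end Summit.AtomisticToContinuum.Crystallization.Theorems
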